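import Summits.ValiantsHypothesis.ValiantsHypothesis.Theorems.FeketeSOSFeketeSOSHardPaleyRIPFlatToGeneral
import Summits.ValiantsHypothesis.ValiantsHypothesis.Theorems.FeketeSOSFeketeSOSHardPaleyRIPFlatRIPDiffSumEquiv
import Summits.ValiantsHypothesis.ValiantsHypothesis.Theorems.FeketeSOSFeketeSOSHardPaleyRIPCompletion
import Mathlib.Analysis.SpecialFunctions.Pow.Real
import Mathlib.Analysis.SpecialFunctions.Log.Basic

/-!
# Route FeketeSOS — crux `FeketeSOSHard` (stmt-ValiantsHypothesis-3996), line `paley-rip`,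
# stub `stub_paleyFlatRIP`: the engine FOLLOWS FROM flat restricted discrepancy of the Paley sum graph

The engine `stub_paleyFlatRIP` of the line of record `Cruxes/FeketeSOSHard/Lines/paley_rip.lean` bounds
the Paley–Hankel quadratic form `Q_p(S,w) = Σ_{a,b∈S} χ_p(a+b) w_a w_b` over ALL complex weights `w` on
supports `#S ≤ p^{1/2+δ₁}` by `p^{1/2−κ} Σ|w_a|²`.  This file proves, sorry-free, that it is implied by
the FLAT (0/1-weight) statement

> `PaleySumDiscrepancy`: `∃ κ, δ > 0 ∀ large p ∀ A, B ⊆ [0,p)` with `#A, #B ≤ p^{1/2+δ}`: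
> `|Σ_{a∈A, b∈B} χ_p(a+b)| ≤ p^{1/2−κ} √(#A·#B)`,

i.e. Chung-type restricted discrepancy of the Paley SUM graph beyond the square-root barrier (Chung, J.
Number Theory 49 (1994), Conj. 2.2 asks for such bounds; under `b ↦ −b` it is the flat restricted
orthogonality of the Paley ETF of Bandeira–Fickus–Mixon–Wong 2013 / Bandeira–Mixon–Moreira 2017, §2):

* `flatRIPAt_of_discrepancyAt` — at one prime and one support `S`: flat discrepancy `θ` on all
  `A, B ⊆ S` gives `|Q_p(S,w)| ≤ (16θ(2 log₂#S + 2) + 8) Σ|w_a|²` (the flat-RIP lemma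
  `norm_cplxForm_le_of_flat` of `…PaleyRIPFlatToGeneral.lean` applied to `M_{ab} = χ_p(a+b)`);
* `flatRIP_of_paleySumDiscrepancy` — the asymptotic statement: `PaleySumDiscrepancy` with exponents
  `(κ, δ)` implies the REGISTERED STATEMENT of `stub_paleyFlatRIP` verbatim, with exponents
  `(min(κ,1/2)/4, δ)` (the logarithm is absorbed by `log p ≤ p^ε/ε`).

* `flatRIP_iff_paleySumDiscrepancy` — with the converse `paleySumDiscrepancy_of_flatRIP`
  (`…PaleyRIPFlatRIPConsequences.lean`, polarisation) this pins the line's engine, in kernel, to a 0/1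
  discrepancy statement about the Paley sum graph: `stub_paleyFlatRIP ⟺ PaleySumDiscrepancy` (as
  `∃`-statements over the exponents).  All "wild coefficient" difficulty of the crux therefore sits in
  `stub_tameReduction`, none in the engine.
* `flatRIP_iff_paleyDiffDiscrepancy` — the same with the Paley-GRAPH pattern `χ_p(a−b)` (via
  `paleySumDiscrepancy_iff_paleyDiffDiscrepancy`, reflection `b ↦ −b`): the engine is, verbatim up to
  exponents, flat restricted discrepancy of the Paley graph beyond `√p` — the statement the literature
  discusses (Chung 1994 Conj. 2.2; BMM17 `PaleyDiscrepancy` ⇒ `PaleyRIP` ⇒ `PaleyClique`).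
* `charSum_le_sqrt_p_mul` — the UNCONDITIONAL flat bound at the square-root scale,
  `|Σ_{a∈A,b∈B} χ_p(a+b)| ≤ √p · √(#A·#B)` (the landed completion bound `stub_paleyCompletionBound`
  polarised): the engine asks for `p^{−κ}` better, exactly Chung's exponent-`1/2` barrier.

Honest framing: an implication between two OPEN statements (the hypothesis `hD` below is Chung-class and
unproved); the crux `FeketeSOSHard`, the engine and `stub_tameReduction` remain open; nothing here bears
on `VP ≠ VNP`.
-/

-- the line's namespace repeats a path segment by convention (same as the other paley-rip files)
set_option linter.dupNamespace false

namespace Summit.ValiantsHypothesis.ValiantsHypothesis.Theorems.FeketeSOSHardPaleyRIP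

open Finset
open scoped BigOperators

noncomputable section

section AtOnePrime

variable (p : ℕ) [Fact p.Prime]

/-- The Paley–Hankel form is the complex quadratic form of the REAL matrix `(χ_p(a+b))`. [folklore] -/
theorem paleyForm_eq_cplxForm (S : Finset ℕ) (w : ℕ → ℂ) :
    paleyForm p S w =
      ∑ a ∈ S, ∑ b ∈ S, ((((legendreSym p ((a : ℤ) + b) : ℤ) : ℝ) : ℂ)) * w a * w b := by
  unfold paleyForm
  simp only [Complex.ofReal_intCast]

/-- `|χ_p| ≤ 1` as a real number. [folklore] -/
theorem abs_legendreSym_cast_le_one (x : ℤ) : |((legendreSym p x : ℤ) : ℝ)| ≤ 1 := by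
  rcases quadraticChar_isQuadratic (ZMod p) (x : ZMod p) with h | h | h <;>
    · unfold legendreSym; rw [h]; simp

/-- The complex norm of a flat character sum is the absolute value of the real one. [folklore] -/
theorem norm_charSum_eq_abs (A B : Finset ℕ) :
    ‖∑ a ∈ A, ∑ b ∈ B, ((legendreSym p ((a : ℤ) + b) : ℤ) : ℂ)‖ =
      |∑ a ∈ A, ∑ b ∈ B, ((legendreSym p ((a : ℤ) + b) : ℤ) : ℝ)| := by
  have h : ∑ a ∈ A, ∑ b ∈ B, ((legendreSym p ((a : ℤ) + b) : ℤ) : ℂ) =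
      ((∑ a ∈ A, ∑ b ∈ B, ((legendreSym p ((a : ℤ) + b) : ℤ) : ℝ) : ℝ) : ℂ) := by
    push_cast
    rfl
  rw [h, Complex.norm_real, Real.norm_eq_abs]

/-- **Flat discrepancy on `S` ⇒ the engine's inequality on `S`, at one prime** (flat-RIP lemma applied to
`M_{ab} = χ_p(a+b)`): if `|Σ_{a∈A,b∈B} χ_p(a+b)| ≤ θ √(#A·#B)` for all `A, B ⊆ S` (`θ ≥ 0`), then
`|Q_p(S,w)| ≤ (16θ(2 log₂#S + 2) + 8) Σ_{a∈S}|w_a|²` for every `w : ℕ → ℂ`. [folklore] -/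
theorem flatRIPAt_of_discrepancyAt (θ : ℝ) (hθ : 0 ≤ θ) (S : Finset ℕ)
    (hdisc : ∀ A ⊆ S, ∀ B ⊆ S, ‖∑ a ∈ A, ∑ b ∈ B, ((legendreSym p ((a : ℤ) + b) : ℤ) : ℂ)‖ ≤
      θ * Real.sqrt ((A.card : ℝ) * B.card))
    (w : ℕ → ℂ) :
    ‖paleyForm p S w‖ ≤ (16 * θ * (2 * Nat.log 2 S.card + 2) + 8) * ∑ a ∈ S, ‖w a‖ ^ 2 := by
  rw [paleyForm_eq_cplxForm]
  refine norm_cplxForm_le_of_flat S (fun a b => ((legendreSym p ((a : ℤ) + b) : ℤ) : ℝ))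
    (fun a b => abs_legendreSym_cast_le_one p _) θ hθ ?_ w
  intro A hA B hB
  rw [← norm_charSum_eq_abs, ← Real.sqrt_mul (Nat.cast_nonneg _)]
  exact hdisc A hA B hB

end AtOnePrime

section Asymptotic

/-- `Nat.log 2 K ≤ log p / log 2` for `K ≤ p`, `p ≥ 1`. [folklore] -/
theorem natLog_two_le_log_div (K p : ℕ) (hK : K ≤ p) (hp : 1 ≤ p) :
    (Nat.log 2 K : ℝ) ≤ Real.log p / Real.log 2 := by
  have hl2 : 0 < Real.log 2 := Real.log_pos (by norm_num)
  rw [le_div_iff₀ hl2, ← Real.log_pow]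
  have hmono : Nat.log 2 K ≤ Nat.log 2 p := Nat.log_mono_right hK
  have hpow : 2 ^ Nat.log 2 p ≤ p := Nat.pow_log_le_self 2 (by omega)
  have h1 : (2 : ℝ) ^ Nat.log 2 K ≤ (p : ℝ) := by
    calc (2 : ℝ) ^ Nat.log 2 K ≤ (2 : ℝ) ^ Nat.log 2 p := pow_le_pow_right₀ (by norm_num) hmono
      _ ≤ (p : ℝ) := by exact_mod_cast hpow
  exact Real.log_le_log (by positivity) h1

/-- **The engine follows from flat restricted discrepancy of the Paley sum graph beyond `√p`.**
If `∃ κ, δ > 0 ∀ p ≥ p₁` prime `∀ A, B ⊆ [0,p)` with `#A, #B ≤ p^{1/2+δ}`: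
`|Σ_{a∈A,b∈B} χ_p(a+b)| ≤ p^{1/2−κ} √(#A·#B)` (Chung-type discrepancy, OPEN), then the registered
statement of `stub_paleyFlatRIP` holds (with exponents `min(κ,1/2)/4` and `δ`).  Proof:
`flatRIPAt_of_discrepancyAt` on each admissible `S`, then `log₂#S ≤ log p/log 2 ≤ p^{κ/2}/((κ/2) log 2)`
and a threshold `p₁`. [folklore] -/
theorem flatRIP_of_paleySumDiscrepancy
    (hD : ∃ κ : ℝ, 0 < κ ∧ ∃ δ : ℝ, 0 < δ ∧ ∃ p₁ : ℕ, ∀ (p : ℕ) [Fact p.Prime], p₁ ≤ p →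
      ∀ (A B : Finset ℕ), (∀ a ∈ A, a < p) → (∀ b ∈ B, b < p) →
        (A.card : ℝ) ≤ (p : ℝ) ^ (1 / 2 + δ) → (B.card : ℝ) ≤ (p : ℝ) ^ (1 / 2 + δ) →
        ‖∑ a ∈ A, ∑ b ∈ B, ((legendreSym p ((a : ℤ) + b) : ℤ) : ℂ)‖ ≤
          (p : ℝ) ^ (1 / 2 - κ) * Real.sqrt ((A.card : ℝ) * B.card)) :
    ∃ κ : ℝ, 0 < κ ∧ ∃ δ₁ : ℝ, 0 < δ₁ ∧ ∃ p₁ : ℕ, ∀ (p : ℕ) [Fact p.Prime], p₁ ≤ p →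
      ∀ (S : Finset ℕ), (∀ a ∈ S, a < p) → (S.card : ℝ) ≤ (p : ℝ) ^ (1 / 2 + δ₁) →
      ∀ (w : ℕ → ℂ), ‖paleyForm p S w‖ ≤ (p : ℝ) ^ (1 / 2 - κ) * ∑ a ∈ S, ‖w a‖ ^ 2 := by
  classical
  obtain ⟨κ₀, hκ₀, δ, hδ, p₁, hD⟩ := hD
  -- shrink the exponent so that `p^{1/2-κ} ≥ 1`
  set κ : ℝ := min κ₀ (1 / 2) with hκdef
  have hκ : 0 < κ := lt_min hκ₀ (by norm_num)
  have hκle : κ ≤ κ₀ := min_le_left _ _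
  have hκhalf : κ ≤ 1 / 2 := min_le_right _ _
  -- the constant absorbing the logarithm
  set ε : ℝ := κ / 2 with hεdef
  have hε : 0 < ε := by positivity
  have hl2 : 0 < Real.log 2 := Real.log_pos (by norm_num)
  set Cst : ℝ := 32 / (ε * Real.log 2) + 40 with hCst
  have hCst0 : 0 < Cst := by positivity
  obtain ⟨N, hN⟩ : ∃ N : ℕ, Cst ^ (1 / (κ / 4)) ≤ (N : ℝ) := ⟨_, Nat.le_ceil _⟩
  refine ⟨κ / 4, by positivity, δ, hδ, max p₁ N, ?_⟩
  intro p _ hp S hS hScard w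
  have hprime : p.Prime := Fact.out
  have hp0 : (0 : ℝ) < (p : ℝ) := by exact_mod_cast hprime.pos
  have hp1 : (1 : ℝ) ≤ (p : ℝ) := by exact_mod_cast hprime.one_lt.le
  have hp₁ : p₁ ≤ p := le_trans (le_max_left _ _) hp
  have hpN : (N : ℝ) ≤ (p : ℝ) := by exact_mod_cast le_trans (le_max_right _ _) hp
  -- flat discrepancy on subsets of `S`
  set θ₀ : ℝ := (p : ℝ) ^ (1 / 2 - κ₀) with hθ₀
  have hθ₀0 : 0 ≤ θ₀ := Real.rpow_nonneg hp0.le _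
  have hdisc : ∀ A ⊆ S, ∀ B ⊆ S, ‖∑ a ∈ A, ∑ b ∈ B, ((legendreSym p ((a : ℤ) + b) : ℤ) : ℂ)‖ ≤
      θ₀ * Real.sqrt ((A.card : ℝ) * B.card) := by
    intro A hA B hB
    refine hD p hp₁ A B (fun a ha => hS a (hA ha)) (fun b hb => hS b (hB hb)) ?_ ?_
    · exact le_trans (by exact_mod_cast card_le_card hA) hScard
    · exact le_trans (by exact_mod_cast card_le_card hB) hScard
  have hmain := flatRIPAt_of_discrepancyAt p θ₀ hθ₀0 S hdisc w
  -- bookkeeping: `16 θ₀ (2 log₂ #S + 2) + 8 ≤ p^{1/2 - κ/4}`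
  have hW : 0 ≤ ∑ a ∈ S, ‖w a‖ ^ 2 := sum_nonneg fun a _ => sq_nonneg _
  set θ : ℝ := (p : ℝ) ^ (1 / 2 - κ) with hθ
  have hθ1 : 1 ≤ θ := Real.one_le_rpow hp1 (by linarith)
  have hθ₀le : θ₀ ≤ θ := Real.rpow_le_rpow_of_exponent_le hp1 (by linarith)
  have hKp : S.card ≤ p := by
    have : S ⊆ Finset.range p := fun a ha => Finset.mem_range.2 (hS a ha)
    simpa using card_le_card this
  have hL : (Nat.log 2 S.card : ℝ) ≤ Real.log p / Real.log 2 :=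
    natLog_two_le_log_div S.card p hKp hprime.one_lt.le
  have hlog : Real.log p ≤ (p : ℝ) ^ ε / ε := Real.log_le_rpow_div hp0.le hε
  have hpε1 : 1 ≤ (p : ℝ) ^ ε := Real.one_le_rpow hp1 hε.le
  have hL' : (Nat.log 2 S.card : ℝ) ≤ (p : ℝ) ^ ε / (ε * Real.log 2) := by
    calc (Nat.log 2 S.card : ℝ) ≤ Real.log p / Real.log 2 := hL
      _ ≤ ((p : ℝ) ^ ε / ε) / Real.log 2 := div_le_div_of_nonneg_right hlog hl2.le
      _ = (p : ℝ) ^ ε / (ε * Real.log 2) := by rw [div_div]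
  have hcoef : 16 * θ₀ * (2 * Nat.log 2 S.card + 2) + 8 ≤ θ * ((p : ℝ) ^ ε * Cst) := by
    have h1 : 16 * θ₀ * (2 * Nat.log 2 S.card + 2) + 8 ≤ θ * (32 * Nat.log 2 S.card + 40) := by
      have hLnn : (0 : ℝ) ≤ Nat.log 2 S.card := Nat.cast_nonneg _
      nlinarith
    have h2 : (32 : ℝ) * Nat.log 2 S.card + 40 ≤ (p : ℝ) ^ ε * Cst := by
      rw [hCst, mul_add]
      have h3 : (32 : ℝ) * Nat.log 2 S.card ≤ (p : ℝ) ^ ε * (32 / (ε * Real.log 2)) := by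
        have := mul_le_mul_of_nonneg_left hL' (by norm_num : (0 : ℝ) ≤ 32)
        calc (32 : ℝ) * Nat.log 2 S.card ≤ 32 * ((p : ℝ) ^ ε / (ε * Real.log 2)) := this
          _ = (p : ℝ) ^ ε * (32 / (ε * Real.log 2)) := by ring
      nlinarith
    exact h1.trans (mul_le_mul_of_nonneg_left h2 (by linarith))
  -- the threshold: `Cst ≤ p^{κ/4}` for `p ≥ N`
  have hCle : Cst ≤ (p : ℝ) ^ (κ / 4) := by
    have h0 : (0 : ℝ) ≤ Cst ^ (1 / (κ / 4)) := Real.rpow_nonneg hCst0.le _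
    calc Cst = (Cst ^ (1 / (κ / 4))) ^ (κ / 4) := by
          rw [one_div, Real.rpow_inv_rpow hCst0.le (by positivity)]
      _ ≤ (p : ℝ) ^ (κ / 4) := Real.rpow_le_rpow h0 (hN.trans hpN) (by positivity)
  have hexp : θ * ((p : ℝ) ^ ε * (p : ℝ) ^ (κ / 4)) = (p : ℝ) ^ (1 / 2 - κ / 4) := by
    rw [hθ, hεdef, ← Real.rpow_add hp0, ← Real.rpow_add hp0]
    ring_nf
  calc ‖paleyForm p S w‖ ≤ (16 * θ₀ * (2 * Nat.log 2 S.card + 2) + 8) * ∑ a ∈ S, ‖w a‖ ^ 2 := hmain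
    _ ≤ θ * ((p : ℝ) ^ ε * Cst) * ∑ a ∈ S, ‖w a‖ ^ 2 := mul_le_mul_of_nonneg_right hcoef hW
    _ ≤ θ * ((p : ℝ) ^ ε * (p : ℝ) ^ (κ / 4)) * ∑ a ∈ S, ‖w a‖ ^ 2 := by
        apply mul_le_mul_of_nonneg_right _ hW
        apply mul_le_mul_of_nonneg_left _ (by linarith)
        exact mul_le_mul_of_nonneg_left hCle (by positivity)
    _ = (p : ℝ) ^ (1 / 2 - κ / 4) * ∑ a ∈ S, ‖w a‖ ^ 2 := by rw [hexp]

/-- **The engine ⟺ flat restricted discrepancy of the Paley sum graph** (both as `∃`-statements over the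
exponents): `→` is polarisation (`paleySumDiscrepancy_of_flatRIP`), `←` is the flat-RIP lemma
(`flatRIP_of_paleySumDiscrepancy`).  Both sides are OPEN (Chung 1994 Conj. 2.2 class). [folklore] -/
theorem flatRIP_iff_paleySumDiscrepancy :
    (∃ κ : ℝ, 0 < κ ∧ ∃ δ₁ : ℝ, 0 < δ₁ ∧ ∃ p₁ : ℕ, ∀ (p : ℕ) [Fact p.Prime], p₁ ≤ p →
      ∀ (S : Finset ℕ), (∀ a ∈ S, a < p) → (S.card : ℝ) ≤ (p : ℝ) ^ (1 / 2 + δ₁) →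
      ∀ (w : ℕ → ℂ), ‖paleyForm p S w‖ ≤ (p : ℝ) ^ (1 / 2 - κ) * ∑ a ∈ S, ‖w a‖ ^ 2) ↔
    (∃ κ : ℝ, 0 < κ ∧ ∃ δ : ℝ, 0 < δ ∧ ∃ p₁ : ℕ, ∀ (p : ℕ) [Fact p.Prime], p₁ ≤ p →
      ∀ (A B : Finset ℕ), (∀ a ∈ A, a < p) → (∀ b ∈ B, b < p) →
        (A.card : ℝ) ≤ (p : ℝ) ^ (1 / 2 + δ) → (B.card : ℝ) ≤ (p : ℝ) ^ (1 / 2 + δ) →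
        ‖∑ a ∈ A, ∑ b ∈ B, ((legendreSym p ((a : ℤ) + b) : ℤ) : ℂ)‖ ≤
          (p : ℝ) ^ (1 / 2 - κ) * Real.sqrt ((A.card : ℝ) * B.card)) :=
  ⟨paleySumDiscrepancy_of_flatRIP, flatRIP_of_paleySumDiscrepancy⟩

/-- **The engine ⟺ flat restricted discrepancy of the Paley GRAPH** (difference pattern `χ_p(a−b)`),
as `∃`-statements over the exponents — the line's engine is literally the Paley-graph discrepancy
statement beyond `√p` of the literature (Chung 1994 Conj. 2.2 class; Bandeira–Mixon–Moreira 2017 §2).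
[folklore] -/
theorem flatRIP_iff_paleyDiffDiscrepancy :
    (∃ κ : ℝ, 0 < κ ∧ ∃ δ₁ : ℝ, 0 < δ₁ ∧ ∃ p₁ : ℕ, ∀ (p : ℕ) [Fact p.Prime], p₁ ≤ p →
      ∀ (S : Finset ℕ), (∀ a ∈ S, a < p) → (S.card : ℝ) ≤ (p : ℝ) ^ (1 / 2 + δ₁) →
      ∀ (w : ℕ → ℂ), ‖paleyForm p S w‖ ≤ (p : ℝ) ^ (1 / 2 - κ) * ∑ a ∈ S, ‖w a‖ ^ 2) ↔
    (∃ κ : ℝ, 0 < κ ∧ ∃ δ : ℝ, 0 < δ ∧ ∃ p₁ : ℕ, ∀ (p : ℕ) [Fact p.Prime], p₁ ≤ p →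
      ∀ (A B : Finset ℕ), (∀ a ∈ A, a < p) → (∀ b ∈ B, b < p) →
        (A.card : ℝ) ≤ (p : ℝ) ^ (1 / 2 + δ) → (B.card : ℝ) ≤ (p : ℝ) ^ (1 / 2 + δ) →
        ‖∑ a ∈ A, ∑ b ∈ B, ((legendreSym p ((a : ℤ) - b) : ℤ) : ℂ)‖ ≤
          (p : ℝ) ^ (1 / 2 - κ) * Real.sqrt ((A.card : ℝ) * B.card)) :=
  flatRIP_iff_paleySumDiscrepancy.trans paleySumDiscrepancy_iff_paleyDiffDiscrepancy

/-- **The unconditional square-root bound** (what IS known, Chung's exponent `1/2`): for every prime `p`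
and all `A, B ⊆ [0,p)`, `|Σ_{a∈A,b∈B} χ_p(a+b)| ≤ √p · √(#A·#B)` — the landed completion bound
`stub_paleyCompletionBound` polarised on `A ∪ B`.  The engine asks for `p^{1/2−κ}` in place of `√p` on
sets of size `≤ p^{1/2+δ₁}`. [folklore] -/
theorem charSum_le_sqrt_p_mul (p : ℕ) [Fact p.Prime] (A B : Finset ℕ) (hA : ∀ a ∈ A, a < p)
    (hB : ∀ b ∈ B, b < p) :
    ‖∑ a ∈ A, ∑ b ∈ B, ((legendreSym p ((a : ℤ) + b) : ℤ) : ℂ)‖ ≤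
      Real.sqrt p * Real.sqrt ((A.card : ℝ) * B.card) := by
  classical
  refine norm_charSum_le_of_quad p (Real.sqrt p) (A ∪ B) (fun w => ?_) A B subset_union_left
    subset_union_right
  refine stub_paleyCompletionBound p (A ∪ B) (fun a ha => ?_) w
  rcases mem_union.1 ha with h | h
  · exact hA a h
  · exact hB a h

end Asymptotic

end

end Summit.ValiantsHypothesis.ValiantsHypothesis.Theorems.FeketeSOSHardPaleyRIP
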